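import Summits.HodgeConjecture.HodgeConjecture.Theses.SignSymmetricPowers
import Literature.AlgebraicGeometry.Motives.FermatHypersurface
import Literature.AlgebraicGeometry.Motives.CurveNet
import Literature.AlgebraicGeometry.Motives.HodgeTensorFactsHolds
import Literature.AlgebraicGeometry.HodgeTheory.HodgeFiltrationModelsReductionProofs
import Literature.AlgebraicGeometry.HodgeTheory.SymmetricHypersurfaceInvolution
import Literature.AlgebraicGeometry.HodgeTheory.DiagonalSymmetry
import Literature.AlgebraicGeometry.HodgeTheory.BettiUniverseIsoTransport

/-!
# K1 transfer step (route `SignSymmetricPowers`, item stmt-HodgeConjecture-19716) — models to all members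

Discharges the registered stub `stub_modelTransfer` (skeleton `b811d9d98d56`, K1 line `andre-zariski`,
active stubs `stub_signDeckModel`, `stub_signPencilEnvelope`, `stub_cdkCover`, `stub_cmsp1537`,
`stub_modelTransfer`) of crux `VeryGeneralSignCommutatorsInHg` (rank 2) of route
`route-HodgeConjecture-SignSymmetricPowers`; landed `--supports stmt-HodgeConjecture-19716` (it does not
close the item).  Sorry-free; axioms `propext`, `Classical.choice`, `Quot.sound`.

## Statement

`stub_modelTransfer` — stated with the registered signature VERBATIM (the shared `let`-prefix `pmul2`,
`fac`, `shn`, `Deck`, `Cen`, `Comm` of the route file `Theses/SignSymmetricPowers.lean`): if K1 holds for the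
MODELS `X_f = SmoothHypersurface.hypersurface f` with the deck transformation `σ = diagonalAut f ha` of the
sign unit `a = (-1,-1,1,1,1) ∈ diagonalStabilizer f` (every ι-even `f`), then K1 holds as typed in the
route, i.e. for every `X` with `IsHypersurfaceCutOutBy 4 f X`: transport along an identification
`e : X ≅ X_f`.

## Proof

`IsHypersurfaceCutOutBy.nonempty_iso_hypersurface` gives `e : X ≅ X_f`; `IsSmoothProjective.of_iso`
moves smoothness to the model; `signUnits_two_mem_diagonalStabilizer` (p497458) supplies `ha` from
ι-evenness; the model statement gives `Deck ∧ Comm` for `diagonalAut f ha`; the three `Deck` clauses and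
`Comm` are transported to `σ := e.hom ≫ diagonalAut f ha ≫ e.inv` by the iso-transport kit of
`BettiUniverseIsoTransport` (p499184: `pull_conj_sq_eq_one_of_iso`, `tr_cup_pull_conj_of_iso`,
`finrank_eigenspace_inf_piece_eq_of_iso`, `comm_of_iso`), the Hodge pieces being model-independent
(`hodgePQ_independent_of_hodgeModel_holds`).  Proof term: littype-FH1-2 g5 witness
(HOME/littype-FH1-2/ModelTransferWitness-g5.lean, sha256/16 3a6af89b96b37ff1), repackaged def-free.
-/

noncomputable section

namespace Summit.HodgeConjecture.HodgeConjecture.Theorems.SignSymmetricPowersModelTransfer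

open Literature.AlgebraicGeometry.Motives Literature.AlgebraicGeometry.HodgeTheory
open Literature.AlgebraicGeometry.HodgeTheory.BettiUniverse
open Literature.AlgebraicTopology.SingularHomology
open CategoryTheory

/-- Registered stub `stub_modelTransfer` of the K1 line `andre-zariski` (item stmt-HodgeConjecture-19716,
skeleton `b811d9d98d56`): K1 for the models `X_f` with `σ = diagonalAut f ha` implies
`VeryGeneralSignCommutatorsInHg`.  Signature = the registered one, verbatim. -/
theorem stub_modelTransfer :
    open Literature.AlgebraicGeometry.Motives Literature.AlgebraicGeometry.HodgeTheory Literature.AlgebraicGeometry.HodgeTheory.BettiUniverse CategoryTheory.Limits in let pmul2 : List (ℕ × ℕ) → List (ℕ × ℕ) → List (ℕ × ℕ) := fun a b => (List.range (a.length + b.length - 1)).map fun k => (((List.range (k + 1)).map fun i => (a.getD i (0, 0)).1 * (b.getD (k - i) (0, 0)).1 + (a.getD i (0, 0)).2 * (b.getD (k - i) (0, 0)).2).sum, ((List.range (k + 1)).map fun i => (a.getD i (0, 0)).1 * (b.getD (k - i) (0, 0)).2 + (a.getD i (0, 0)).2 * (b.getD (k - i) (0, 0)).1).sum); let fac : ℕ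 → Bool → List (ℕ × ℕ) := fun d odd => (List.range (d - 1)).map fun k => if odd ∧ ¬ Even k then (0, 1) else (1, 0); let shn : ℕ → ℕ → ℕ → ℕ := fun d j q => if (q + 1) * d < 5 then 0 else if j = 0 then (([fac d true, fac d false, fac d false, fac d false].foldl pmul2 (fac d true)).getD ((q + 1) * d - 5) (0, 0)).1 else (([fac d true, fac d false, fac d false, fac d false].foldl pmul2 (fac d true)).getD ((q + 1) * d - 5) (0, 0)).2; let Deck : (d : ℕ) → (X : SchemeOver ℂ) → IsSmoothProjective 3 X → (X ⟶ X) → Prop := fun d X hX σ => pull σ 3 ^ 2 = 1 ∧ (∀ x y, tr hX (3 + 3) (cup X 3 3 (pull σ 3 x) (pull σ 3 y)) = tr hX (3 + 3) (cup X 3 3 x y)) ∧ ∀ j q : ℕ, j < 2 → q ≤ 3 → Module.finrank ℂ ↥(Module.End.eigenspace ((pull σ 3).baseChange ℂ) ((-1 : ℂ) ^ j) ⊓ (hodge exists_isReal_hodgeModel_holds hX 3).piece ((3 : ℤ) - q) q) = shn d j q; let Cen : (X : SchemeOver ℂ) → IsSmoothProjective 3 X → (X ⟶ X) → (bettiCohomology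 X 3 ≃ₗ[ℚ] bettiCohomology X 3) → Prop := fun X hX σ g => (∀ x, g (pull σ 3 x) = pull σ 3 (g x)) ∧ ∀ x y, tr hX (3 + 3) (cup X 3 3 (g x) (g y)) = tr hX (3 + 3) (cup X 3 3 x y); let Comm : (X : SchemeOver ℂ) → IsSmoothProjective 3 X → (X ⟶ X) → Prop := fun X hX σ => haveI := finite hX 3; haveI : HodgeTensorFacts.{0, 0} := hodgeTensorFacts_holds; ∀ g h : bettiCohomology X 3 ≃ₗ[ℚ] bettiCohomology X 3, Cen X hX σ g → Cen X hX σ h → g * h * g⁻¹ * h⁻¹ ∈ (hodge exists_isReal_hodgeModel_holds hX 3).hodgeGroup; (∀ ⦃d : ℕ⦄, Even d → 4 ≤ d → ∃ g : ℕ → MvPolynomial {e : Fin 5 →₀ ℕ // e.degree = d} ℂ, (∀ i, ∃ f : MvPolynomial (Fin 5) ℂ, f.IsHomogeneous d ∧ (∀ e : Fin 5 →₀ ℕ, ¬ Even (e 0 + e 1) → f.coeff e = 0) ∧ MvPolynomial.eval (fun e : {e : Fin 5 →₀ ℕ // e.degree = d} => f.coeff e.1) (g i) ≠ 0) ∧ ∀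 f : MvPolynomial (Fin 5) ℂ, f.IsHomogeneous d → (∀ e : Fin 5 →₀ ℕ, ¬ Even (e 0 + e 1) → f.coeff e = 0) → (∀ i, MvPolynomial.eval (fun e : {e : Fin 5 →₀ ℕ // e.degree = d} => f.coeff e.1) (g i) ≠ 0) → ∀ (hXF : IsSmoothProjective 3 (SmoothHypersurface.hypersurface f)) (ha : (fun i : Fin 5 => if (i : ℕ) < 2 then (-1 : ℂˣ) else 1) ∈ diagonalStabilizer f), Deck d (SmoothHypersurface.hypersurface f) hXF (diagonalAut f ha) ∧ Comm (SmoothHypersurface.hypersurface f) hXF (diagonalAut f ha)) → Summit.HodgeConjecture.HodgeConjecture.Theses.SignSymmetricPowers.VeryGeneralSignCommutatorsInHg := by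
  intro pmul2 fac shn Deck Cen Comm hModel d hd h4
  obtain ⟨g, hg, hmain⟩ := hModel hd h4
  refine ⟨g, hg, fun f hf hι hgen X hX hcut ↦ ?_⟩
  obtain ⟨e⟩ := hcut.nonempty_iso_hypersurface
  have hXF : IsSmoothProjective 3 (SmoothHypersurface.hypersurface f) := hX.of_iso e
  have ha := signUnits_two_mem_diagonalStabilizer f hι
  obtain ⟨hDeck, hComm⟩ := hmain f hf hι hgen hXF ha
  dsimp only [Deck, Cen, Comm] at hDeck hComm ⊢
  obtain ⟨h1, h2, h3⟩ := hDeck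
  refine ⟨e.hom ≫ diagonalAut f ha ≫ e.inv, ⟨pull_conj_sq_eq_one_of_iso e h1,
    tr_cup_pull_conj_of_iso hX hXF e h2, fun j q hj hq ↦ ?_⟩, ?_⟩
  · rw [finrank_eigenspace_inf_piece_eq_of_iso exists_isReal_hodgeModel_holds
      hodgePQ_independent_of_hodgeModel_holds hX hXF e (diagonalAut f ha) 3]
    exact h3 j q hj hq
  · haveI : HodgeTensorFacts.{0, 0} := hodgeTensorFacts_holds
    exact comm_of_iso exists_isReal_hodgeModel_holds hodgePQ_independent_of_hodgeModel_holds hX hXF e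
      (diagonalAut f ha) 3 hComm

end Summit.HodgeConjecture.HodgeConjecture.Theorems.SignSymmetricPowersModelTransfer

end
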